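import Summits.Ventures.PercRepro.RankLevelSetExplicitLin2KeyL

/-!
# PercRepro — THE LEVEL-13 THEOREM-M ROW OF C-025 OVER THE 5/8 RANGE: THE KEY AT `p = 5 401` (p9, S4; the key is p4's)

`proofs/SUBCLAIM-S4-p9.md` §S4.2⁗⁗. p4's THEOREM-M key `KeyL 13 p d` (RankLevelSetExplicitLin2KeyL) checked by the kernel at
`p = 5 401` on the coranks `14 ≤ d ≤ 5133` of THE 5/8 RANGE (`D' = 13 + 5·2^{10} = 5133`; the large-corank theorem
`c025_core_explicit_large_of58` takes the coranks beyond): `5 401` = the least `p` with the optimal Chernoff pair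
`16·n^n ≤ 2^n·(n − K)^{n−K}·K^K` at `n = p + D'`, `K = 13 + D'` (twin lean-drafts/p9/g7/twin/range58.py), at or above the key's
own floor and the bases `N₁ = 5 274`, `P₂ = 5 161` (RankLevelSetExplicitLin2Bases58); p4's sharp row sits at `8 536`
(RankLevelSetExplicitLin2IndepFloorS). The level step and the unconditional chain are RankLevelSetExplicitLin2IndepFloor58.
Axioms: standard (kernel `decide`).
-/

namespace PercRepro

namespace ThmN

namespace Explicit

/-- The THEOREM-M key row at `(q, p) = (13, 5 401)`, chunk 1 of 3: coranks `14 … 2061`, by the kernel. -/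
theorem key_thirteen_indep58_row_1 : ∀ t < 2048, KeyL 13 5401 (14 + t) := by decide +kernel

/-- The THEOREM-M key row at `(q, p) = (13, 5 401)`, chunk 2 of 3: coranks `2062 … 4109`, by the kernel. -/
theorem key_thirteen_indep58_row_2 : ∀ t < 2048, KeyL 13 5401 (14 + (2048 + t)) := by decide +kernel

/-- The THEOREM-M key row at `(q, p) = (13, 5 401)`, chunk 3 of 3: coranks `4110 … 5133`, by the kernel. -/
theorem key_thirteen_indep58_row_3 : ∀ t < 1024, KeyL 13 5401 (14 + (4096 + t)) := by decide +kernel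

/-- **THE THEOREM-M KEY ROW AT `(q, p) = (13, 5 401)` OVER THE 5/8 RANGE**: `KeyL 13 5401 d` at every corank `14 ≤ d ≤ 5133` (the 3 chunks). -/
theorem key_thirteen_indep58_row : ∀ t < 5120, KeyL 13 5401 (14 + t) :=
  ball_lt_add (fun t => KeyL 13 5401 (14 + t)) 4096 1024
    (ball_lt_add (fun t => KeyL 13 5401 (14 + t)) 2048 2048
    key_thirteen_indep58_row_1 key_thirteen_indep58_row_2) key_thirteen_indep58_row_3

end Explicit

end ThmN

end PercRepro
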